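import Literature.Analysis.FluidPDE.HomSobolevRepresentedL3
import HarnessLib

/-!
# `L³(ℝ³)` data have uniformly locally finite, decaying local energy

Analysis/FluidPDE support file, definitions-free. The local Leray / local energy solutions
through which the tree's Rusin–Šverák facts are to be proved (`IsLocalLeraySolution`,
`LocalLeraySolutions.lean`: Lemarié-Rieusset 2002/2016, Jia–Šverák 2013/2014, Kang–Miura–Tsai
2021) take data in `E² = {v₀ ∈ L²_uloc | ∫_{B_1(x₀)} |v₀|² → 0 as |x₀| → ∞}`, and their a priori
estimate — Rusin–Šverák 2011, Lemma 4.1 ("`‖u‖²_{E(Q̃_{x₀,r})} ≤ C(‖u₀‖_{Ḣ^{1/2}}) r`");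
Jia–Šverák 2013, Lemma 2 and Cor. 1 ("`α = sup_{x₀} ∫_{B_R(x₀)} |u₀|²/2 ≤ ‖u₀‖²_{L³} R`");
Lemarié-Rieusset 2016, Prop. 15.1 / Thm. 15.11 — is driven by the uniformly local energy of the
datum at scale `R`. This file **proves** the two data-side facts for the tree's data (`L³`
fields, in particular the `Ḣ^{1/2}`-represented fields of `HomSobolev.Represents`, which are
`L³` by `HomSobolevRepresentedL3.lean`):

* `lintegral_ball_enorm_sq_le_of_memLp_three` — **Hölder on balls**:
  `∫_{B_R(x₀)} ‖u₀‖² ≤ R |B_1|^{1/3} ‖u₀‖²_{L³}` for every centre `x₀` and radius `R ≥ 0`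
  (Jia–Šverák 2013, proof of Cor. 1: "`α ≤ sup_{x₀} (∫_{B_R(x₀)}|u₀|³)^{2/3} R ≤ ‖u₀‖²_{L³} R`");
  with `exists_const_lintegral_ball_enorm_sq_le_of_represents`, the `Ḣ^{1/2}` form
  `∫_{B_R(x₀)} ‖u₀‖² ≤ C R ‖g‖²` (Rusin–Šverák 2011, Lemma 4.1 at `t = 0`);
* `tendsto_lintegral_ball_enorm_cube_cocompact`, `tendsto_lintegral_ball_enorm_sq_cocompact` —
  **decay at spatial infinity**: `∫_{B_R(x₀)} ‖u₀‖³ → 0` and `∫_{B_R(x₀)} ‖u₀‖² → 0` as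
  `|x₀| → ∞` (tails of the finite measure `‖u₀‖³ dx`; Mathlib `tendsto_measure_iInter_atTop`),
  i.e. `L³ ⊂ E²` — the standing hypothesis on the datum in Jia–Šverák's definition of Leray
  solutions (2013, Def. 1, (decay)) and Kang–Miura–Tsai 2021, Def. 3.2 (7) at `t = 0`
  (cf. Lemarié-Rieusset 2016, proof of Thm. 15.12: "`∫_{B(x,1)} |u|² ≤ |B(0,1)|^{1/3} ‖u‖²_{L³}`
  and `lim_{x→∞} ∫_{B(x,1)} |u(t,y)|² dy = 0`").

## Mathlib / tree search

Mathlib: `eLpNorm_le_eLpNorm_mul_rpow_measure_univ` (comparison of `L^p` norms on a finite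
measure space), `Measure.addHaar_ball`, `Measure.addHaar_ball_center`, `withDensity_apply`,
`tendsto_measure_iInter_atTop`, `IsCompact.compl_mem_cocompact`. Tree:
`memLp_three_of_represents_complexify`, `exists_const_eLpNorm_three_le_of_represents_complexify`
(`HomSobolevRepresentedL3.lean`).

## References

* W. Rusin, V. Šverák, J. Funct. Anal. 260 (2011) = arXiv:0911.0500, Lemma 4.1.
* H. Jia, V. Šverák, SIAM J. Math. Anal. 45 (2013) = arXiv:1201.1592, Def. 1, Lemma 2, Cor. 1.
* P. G. Lemarié-Rieusset, *The Navier–Stokes problem in the 21st century* (2016), Prop. 15.1,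
  proof of Thm. 15.12.
* K. Kang, H. Miura, T.-P. Tsai, IMRN 2021 = arXiv:1812.10509, Def. 3.2.
-/

noncomputable section

open MeasureTheory Set Function Filter Topology Metric
open scoped ENNReal NNReal

namespace Literature.Analysis.FluidPDE

section LocalEnergy

variable {E' : Type*} [NormedAddCommGroup E']

/-- **Comparison of `L²` and `L³` on a finite measure space** (Hölder/Jensen; Mathlib
`eLpNorm_le_eLpNorm_mul_rpow_measure_univ`, squared): `∫ ‖f‖² dμ ≤ μ(univ)^{1/3} (∫ ‖f‖³ dμ)^{2/3}`.
[folklore] -/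
theorem lintegral_enorm_sq_le_measure_rpow_mul {α : Type*} {m : MeasurableSpace α} (μ : Measure α)
    {f : α → E'} (hf : AEStronglyMeasurable f μ) :
    ∫⁻ x, ‖f x‖ₑ ^ 2 ∂μ ≤ μ univ ^ (1 / 3 : ℝ) * (∫⁻ x, ‖f x‖ₑ ^ 3 ∂μ) ^ (2 / 3 : ℝ) := by
  have h := eLpNorm_le_eLpNorm_mul_rpow_measure_univ (p := 2) (q := 3) (by norm_num) hf
  have e2 : eLpNorm f 2 μ = (∫⁻ x, ‖f x‖ₑ ^ 2 ∂μ) ^ (1 / 2 : ℝ) := by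
    rw [eLpNorm_eq_lintegral_rpow_enorm_toReal two_ne_zero ENNReal.ofNat_ne_top]
    simp [ENNReal.rpow_ofNat]
  have e3 : eLpNorm f 3 μ = (∫⁻ x, ‖f x‖ₑ ^ 3 ∂μ) ^ (1 / 3 : ℝ) := by
    rw [eLpNorm_eq_lintegral_rpow_enorm_toReal (by norm_num) (by norm_num : (3 : ℝ≥0∞) ≠ ⊤)]
    simp only [ENNReal.toReal_ofNat, one_div]
    congr 1
    refine lintegral_congr fun x => ?_
    rw [show (3 : ℝ) = ((3 : ℕ) : ℝ) by norm_num, ENNReal.rpow_natCast]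
  have hexp : (1 / (2 : ℝ≥0∞).toReal - 1 / (3 : ℝ≥0∞).toReal : ℝ) = 1 / 6 := by norm_num
  rw [e2, e3, hexp] at h
  -- square both sides
  have h2 := ENNReal.rpow_le_rpow h (by norm_num : (0 : ℝ) ≤ 2)
  rw [← ENNReal.rpow_mul, show (1 / 2 : ℝ) * 2 = 1 by norm_num, ENNReal.rpow_one,
    ENNReal.mul_rpow_of_nonneg _ _ (by norm_num : (0 : ℝ) ≤ 2), ← ENNReal.rpow_mul, ← ENNReal.rpow_mul,
    show (1 / 3 : ℝ) * 2 = 2 / 3 by norm_num, show (1 / 6 : ℝ) * 2 = 1 / 3 by norm_num, mul_comm] at h2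
  exact h2

/-- **Local energy of an `L³(ℝ³)` field on a ball**: `∫_{B_R(x₀)} ‖u₀‖² ≤ R |B_1|^{1/3} ‖u₀‖²_{L³}`
for every `x₀ ∈ ℝ³`, `R ≥ 0` (Hölder on the ball, `|B_R|^{1/3} = R |B_1|^{1/3}`). This is the
bound "`α = sup_{x₀} ∫_{B_R(x₀)} |u₀|² ≤ (∫_{B_R(x₀)} |u₀|³)^{2/3} R ≤ ‖u₀‖²_{L³} R`" in the proof
of Jia–Šverák 2013, Cor. 1 (the datum-side input of the Lemarié-Rieusset a priori estimate,
Rusin–Šverák 2011 Lemma 4.1 / Jia–Šverák 2013 Lemma 2). [cite: JiaSverak2013, proof of Cor. 1 (arXiv:1201.1592: α ≤ ‖u₀‖²_{L³} R)] -/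
theorem lintegral_ball_enorm_sq_le_of_memLp_three
    {u₀ : EuclideanSpace ℝ (Fin 3) → E'} (hu : MemLp u₀ 3 volume) (x₀ : EuclideanSpace ℝ (Fin 3))
    {R : ℝ} (hR : 0 ≤ R) :
    ∫⁻ x in ball x₀ R, ‖u₀ x‖ₑ ^ 2 ≤
      ENNReal.ofReal R * volume (ball (0 : EuclideanSpace ℝ (Fin 3)) 1) ^ (1 / 3 : ℝ) *
        eLpNorm u₀ 3 volume ^ 2 := by
  have h1 := lintegral_enorm_sq_le_measure_rpow_mul (volume.restrict (ball x₀ R)) hu.1.restrict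
  rw [Measure.restrict_apply_univ] at h1
  have hvol : volume (ball x₀ R) ^ (1 / 3 : ℝ) =
      ENNReal.ofReal R * volume (ball (0 : EuclideanSpace ℝ (Fin 3)) 1) ^ (1 / 3 : ℝ) := by
    rw [Measure.addHaar_ball volume x₀ hR, finrank_euclideanSpace_fin,
      ENNReal.mul_rpow_of_nonneg _ _ (by norm_num : (0 : ℝ) ≤ 1 / 3),
      ENNReal.ofReal_rpow_of_nonneg (by positivity) (by norm_num), ← Real.rpow_natCast,
      ← Real.rpow_mul hR]
    norm_num
  have h3 : (∫⁻ x in ball x₀ R, ‖u₀ x‖ₑ ^ 3) ^ (2 / 3 : ℝ) ≤ eLpNorm u₀ 3 volume ^ 2 := by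
    have hle : ∫⁻ x in ball x₀ R, ‖u₀ x‖ₑ ^ 3 ≤ ∫⁻ x, ‖u₀ x‖ₑ ^ 3 := setLIntegral_le_lintegral _ _
    have e3 : eLpNorm u₀ 3 volume = (∫⁻ x, ‖u₀ x‖ₑ ^ 3) ^ (1 / 3 : ℝ) := by
      rw [eLpNorm_eq_lintegral_rpow_enorm_toReal (by norm_num) (by norm_num : (3 : ℝ≥0∞) ≠ ⊤)]
      simp only [ENNReal.toReal_ofNat, one_div]
      congr 1
      refine lintegral_congr fun x => ?_
      rw [show (3 : ℝ) = ((3 : ℕ) : ℝ) by norm_num, ENNReal.rpow_natCast]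
    rw [e3, ← ENNReal.rpow_natCast, ← ENNReal.rpow_mul]
    norm_num
    exact ENNReal.rpow_le_rpow hle (by norm_num)
  calc ∫⁻ x in ball x₀ R, ‖u₀ x‖ₑ ^ 2
      ≤ volume (ball x₀ R) ^ (1 / 3 : ℝ) * (∫⁻ x in ball x₀ R, ‖u₀ x‖ₑ ^ 3) ^ (2 / 3 : ℝ) := h1
    _ ≤ ENNReal.ofReal R * volume (ball (0 : EuclideanSpace ℝ (Fin 3)) 1) ^ (1 / 3 : ℝ) *
        eLpNorm u₀ 3 volume ^ 2 := by
        rw [hvol]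
        gcongr

/-- **`L³` fields decay at spatial infinity in the locally uniform sense**:
`∫_{B_R(x₀)} ‖u₀‖³ → 0` as `|x₀| → ∞` (`Filter.cocompact`), for `u₀ ∈ L³(ℝ³)` and any fixed
radius `R`: the tails `∫_{|x| ≥ n} ‖u₀‖³` of the finite measure `‖u₀‖³ dx` tend to `0`
(Mathlib `tendsto_measure_iInter_atTop`), and `B_R(x₀) ⊂ {|x| ≥ n}` once `|x₀| > n + R`.
[folklore] -/
theorem tendsto_lintegral_ball_enorm_cube_cocompact
    {u₀ : EuclideanSpace ℝ (Fin 3) → E'} (hu : MemLp u₀ 3 volume) (R : ℝ) :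
    Tendsto (fun x₀ : EuclideanSpace ℝ (Fin 3) => ∫⁻ x in ball x₀ R, ‖u₀ x‖ₑ ^ 3)
      (cocompact (EuclideanSpace ℝ (Fin 3))) (𝓝 0) := by
  -- the finite measure `‖u₀‖³ dx` and its tails
  set ν : Measure (EuclideanSpace ℝ (Fin 3)) := volume.withDensity fun x => ‖u₀ x‖ₑ ^ 3 with hν
  have hmeas : AEMeasurable (fun x => ‖u₀ x‖ₑ ^ 3) volume := hu.1.enorm.pow_const _
  have hνapp : ∀ s : Set (EuclideanSpace ℝ (Fin 3)), MeasurableSet s → ν s = ∫⁻ x in s, ‖u₀ x‖ₑ ^ 3 :=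
    fun s hs => by rw [hν, withDensity_apply _ hs]
  have hfin : ∫⁻ x, ‖u₀ x‖ₑ ^ 3 < ∞ := by
    have := lintegral_rpow_enorm_lt_top_of_eLpNorm_lt_top (by norm_num) (by norm_num : (3 : ℝ≥0∞) ≠ ⊤)
      hu.eLpNorm_lt_top
    simp only [ENNReal.toReal_ofNat] at this
    refine lt_of_le_of_lt (le_of_eq ?_) this
    refine lintegral_congr fun x => ?_
    rw [show (3 : ℝ) = ((3 : ℕ) : ℝ) by norm_num, ENNReal.rpow_natCast]
  haveI : IsFiniteMeasure ν := by
    refine ⟨?_⟩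
    rw [hνapp _ MeasurableSet.univ, Measure.restrict_univ]
    exact hfin
  set S : ℕ → Set (EuclideanSpace ℝ (Fin 3)) := fun n => (ball (0 : EuclideanSpace ℝ (Fin 3)) n)ᶜ with hS
  have hSanti : Antitone S := fun m n hmn => by
    simp only [hS]
    exact compl_subset_compl.2 (ball_subset_ball (by exact_mod_cast hmn))
  have hSempty : ⋂ n, S n = ∅ := by
    ext x
    simp only [hS, mem_iInter, mem_compl_iff, mem_ball, dist_zero_right, not_lt, mem_empty_iff_false,
      iff_false, not_forall, not_le]
    exact exists_nat_gt ‖x‖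
  have htail : Tendsto (fun n => ν (S n)) atTop (𝓝 0) := by
    have h := tendsto_measure_iInter_atTop (μ := ν) (s := S)
      (fun n => (measurableSet_ball.compl).nullMeasurableSet) hSanti ⟨0, measure_ne_top _ _⟩
    rwa [hSempty, measure_empty] at h
  -- comparison: for `‖x₀‖ ≥ n + R`, `ball x₀ R ⊆ S n`
  rw [ENNReal.tendsto_nhds_zero]
  intro ε hε
  have hev := (ENNReal.tendsto_nhds_zero.1 htail) ε hε
  rw [eventually_atTop] at hev
  obtain ⟨n, hn⟩ := hev
  have hmem : {x₀ : EuclideanSpace ℝ (Fin 3) | (n : ℝ) + R < ‖x₀‖} ∈ cocompact (EuclideanSpace ℝ (Fin 3)) := by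
    have h := (isCompact_closedBall (0 : EuclideanSpace ℝ (Fin 3)) ((n : ℝ) + R)).compl_mem_cocompact
    refine Filter.mem_of_superset h fun x₀ hx₀ => ?_
    simpa [mem_closedBall, dist_zero_right] using hx₀
  refine Filter.mem_of_superset hmem fun x₀ hx₀ => ?_
  have hsub : ball x₀ R ⊆ S n := by
    intro x hx
    simp only [hS, mem_compl_iff, mem_ball, dist_zero_right, not_lt]
    have h1 : dist x x₀ < R := hx
    have h2 : (n : ℝ) + R < ‖x₀‖ := hx₀
    have h3 : ‖x₀‖ ≤ ‖x‖ + dist x x₀ := by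
      calc ‖x₀‖ = dist x₀ 0 := (dist_zero_right x₀).symm
        _ ≤ dist x₀ x + dist x 0 := dist_triangle _ _ _
        _ = ‖x‖ + dist x x₀ := by rw [dist_zero_right, dist_comm, add_comm]
    linarith
  calc ∫⁻ x in ball x₀ R, ‖u₀ x‖ₑ ^ 3 ≤ ∫⁻ x in S n, ‖u₀ x‖ₑ ^ 3 := lintegral_mono_set hsub
    _ = ν (S n) := (hνapp _ measurableSet_ball.compl).symm
    _ ≤ ε := hn n le_rfl

/-- **`L³(ℝ³) ⊂ E²`: the local energy of an `L³` field decays at infinity**,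
`∫_{B_R(x₀)} ‖u₀‖² → 0` as `|x₀| → ∞` (from `tendsto_lintegral_ball_enorm_cube_cocompact` by
Hölder on the ball, `lintegral_enorm_sq_le_measure_rpow_mul`). This is the decay condition on
the datum in Jia–Šverák's definition of Leray solutions (2013, Def. 1) / Kang–Miura–Tsai 2021,
Def. 3.2 (7) at `t = 0`, verified for `L³` data as in Lemarié-Rieusset 2016, proof of
Thm. 15.12 ("`lim_{x → ∞} ∫_{B(x,1)} |u(t,y)|² dy = 0`"). [cite: JiaSverak2013, Def. 1 (arXiv:1201.1592: decay condition, here for the L³ datum)] -/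
theorem tendsto_lintegral_ball_enorm_sq_cocompact
    {u₀ : EuclideanSpace ℝ (Fin 3) → E'} (hu : MemLp u₀ 3 volume) (R : ℝ) :
    Tendsto (fun x₀ : EuclideanSpace ℝ (Fin 3) => ∫⁻ x in ball x₀ R, ‖u₀ x‖ₑ ^ 2)
      (cocompact (EuclideanSpace ℝ (Fin 3))) (𝓝 0) := by
  have hb : ∀ x₀, ∫⁻ x in ball x₀ R, ‖u₀ x‖ₑ ^ 2 ≤
      volume (ball (0 : EuclideanSpace ℝ (Fin 3)) R) ^ (1 / 3 : ℝ) *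
        (∫⁻ x in ball x₀ R, ‖u₀ x‖ₑ ^ 3) ^ (2 / 3 : ℝ) := fun x₀ => by
    have h1 := lintegral_enorm_sq_le_measure_rpow_mul (volume.restrict (ball x₀ R)) hu.1.restrict
    rw [Measure.restrict_apply_univ, Measure.addHaar_ball_center volume x₀ R] at h1
    exact h1
  have hlim : Tendsto (fun x₀ : EuclideanSpace ℝ (Fin 3) =>
      volume (ball (0 : EuclideanSpace ℝ (Fin 3)) R) ^ (1 / 3 : ℝ) *
        (∫⁻ x in ball x₀ R, ‖u₀ x‖ₑ ^ 3) ^ (2 / 3 : ℝ)) (cocompact (EuclideanSpace ℝ (Fin 3))) (𝓝 0) := by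
    have h1 := tendsto_lintegral_ball_enorm_cube_cocompact hu R
    have h2 : Tendsto (fun x₀ : EuclideanSpace ℝ (Fin 3) => (∫⁻ x in ball x₀ R, ‖u₀ x‖ₑ ^ 3) ^ (2 / 3 : ℝ))
        (cocompact (EuclideanSpace ℝ (Fin 3))) (𝓝 0) := by
      have := ((ENNReal.continuous_rpow_const (y := (2 / 3 : ℝ))).tendsto (0 : ℝ≥0∞)).comp h1
      rwa [ENNReal.zero_rpow_of_pos (by norm_num : (0 : ℝ) < 2 / 3)] at this
    have hne : volume (ball (0 : EuclideanSpace ℝ (Fin 3)) R) ^ (1 / 3 : ℝ) ≠ ⊤ :=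
      ENNReal.rpow_ne_top_of_nonneg (by norm_num) measure_ball_lt_top.ne
    have h3 := ENNReal.Tendsto.const_mul h2 (Or.inr hne)
    rwa [mul_zero] at h3
  exact tendsto_of_tendsto_of_tendsto_of_le_of_le tendsto_const_nhds hlim (fun x₀ => zero_le) hb

/-- **Local energy of `Ḣ^{1/2}`-represented data**: there is `C < ∞` such that every real field
`u₀` represented by `g ∈ Ḣ^{1/2}(ℝ³; ℂ³)` satisfies `∫_{B_R(x₀)} ‖u₀‖² ≤ C R ‖g‖²` for all
`x₀ ∈ ℝ³`, `R ≥ 0` (`lintegral_ball_enorm_sq_le_of_memLp_three` with the Sobolev bound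
`‖u₀‖_{L³} ≤ C' ‖g‖`, `exists_const_eLpNorm_three_le_of_represents_complexify`). This is the
`t = 0`, datum-side content of Rusin–Šverák 2011, Lemma 4.1: "`‖u‖²_{E(Q̃_{x₀,r})} ≤ C(‖u₀‖_{Ḣ^{1/2}}) r`"
(the right-hand side is linear in `r` exactly because of this scaling of the datum's local
energy). [cite: RusinSverak2011, Lemma 4.1 (arXiv:0911.0500 p. 7; datum-side bound at t = 0)] -/
theorem exists_const_lintegral_ball_enorm_sq_le_of_represents :
    ∃ C : ℝ≥0∞, C ≠ ⊤ ∧ ∀ (u₀ : EuclideanSpace ℝ (Fin 3) → EuclideanSpace ℝ (Fin 3))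
      (g : FunctionSpaces.HomSobolev (EuclideanSpace ℝ (Fin 3)) (EuclideanSpace ℂ (Fin 3)) (1 / 2 : ℝ)),
      g.Represents (FunctionSpaces.EuclideanSpace.complexify ∘ u₀) →
      ∀ (x₀ : EuclideanSpace ℝ (Fin 3)) {R : ℝ}, 0 ≤ R →
        ∫⁻ x in ball x₀ R, ‖u₀ x‖ₑ ^ 2 ≤ C * ENNReal.ofReal R * ‖g‖ₑ ^ 2 := by
  obtain ⟨C, hC⟩ := exists_const_eLpNorm_three_le_of_represents_complexify
  refine ⟨volume (ball (0 : EuclideanSpace ℝ (Fin 3)) 1) ^ (1 / 3 : ℝ) * (C : ℝ≥0∞) ^ 2,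
    ENNReal.mul_ne_top (ENNReal.rpow_ne_top_of_nonneg (by norm_num) measure_ball_lt_top.ne)
      (ENNReal.pow_ne_top ENNReal.coe_ne_top), fun u₀ g h x₀ R hR => ?_⟩
  have hu : MemLp u₀ 3 volume := memLp_three_of_represents_complexify h
  calc ∫⁻ x in ball x₀ R, ‖u₀ x‖ₑ ^ 2
      ≤ ENNReal.ofReal R * volume (ball (0 : EuclideanSpace ℝ (Fin 3)) 1) ^ (1 / 3 : ℝ) *
          eLpNorm u₀ 3 volume ^ 2 := lintegral_ball_enorm_sq_le_of_memLp_three hu x₀ hR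
    _ ≤ ENNReal.ofReal R * volume (ball (0 : EuclideanSpace ℝ (Fin 3)) 1) ^ (1 / 3 : ℝ) *
          ((C : ℝ≥0∞) * ‖g‖ₑ) ^ 2 := by
        gcongr
        exact hC u₀ g h
    _ = volume (ball (0 : EuclideanSpace ℝ (Fin 3)) 1) ^ (1 / 3 : ℝ) * (C : ℝ≥0∞) ^ 2 *
          ENNReal.ofReal R * ‖g‖ₑ ^ 2 := by ring

/-- **`Ḣ^{1/2}`-represented data are `E²` data**: the local energy `∫_{B_R(x₀)} ‖u₀‖²` of a real
field represented in `Ḣ^{1/2}(ℝ³; ℂ³)` tends to `0` as `|x₀| → ∞`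
(`tendsto_lintegral_ball_enorm_sq_cocompact`, the field being `L³`). Datum-side hypothesis of
Jia–Šverák 2013, Def. 1 / Kang–Miura–Tsai 2021, Def. 3.2, for the data of the tree's
Rusin–Šverák facts. [cite: JiaSverak2013, Def. 1 (arXiv:1201.1592: decay condition, here for the datum)] -/
theorem tendsto_lintegral_ball_enorm_sq_cocompact_of_represents
    {u₀ : EuclideanSpace ℝ (Fin 3) → EuclideanSpace ℝ (Fin 3)}
    {g : FunctionSpaces.HomSobolev (EuclideanSpace ℝ (Fin 3)) (EuclideanSpace ℂ (Fin 3)) (1 / 2 : ℝ)}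
    (h : g.Represents (FunctionSpaces.EuclideanSpace.complexify ∘ u₀)) (R : ℝ) :
    Tendsto (fun x₀ : EuclideanSpace ℝ (Fin 3) => ∫⁻ x in ball x₀ R, ‖u₀ x‖ₑ ^ 2)
      (cocompact (EuclideanSpace ℝ (Fin 3))) (𝓝 0) :=
  tendsto_lintegral_ball_enorm_sq_cocompact (memLp_three_of_represents_complexify h) R

end LocalEnergy

end Literature.Analysis.FluidPDE
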